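import Summits.HubbardSuperconductivity.HubbardSuperconductivity.Theorems.AnisotropyChordTransferKreinJF1
import Summits.HubbardSuperconductivity.HubbardSuperconductivity.Theorems.AnisotropyChordTransferFibre3Invertible

/-!
# Route `AnisotropyChord` / H0 rotor rung: the abstract SADDLE-POINT LOWER BOUND behind (KT-EXACT)

Memo ROTOR-THEORY-20 §282(a)/§283(a) and ROTOR-THEORY-21 §301 STEP 2 (theory seat `hubbard-h0-rotor-theory-1`), abstract
finite-dimensional layer.  Let `N = [[P, Bᴴ],[B, C]]` be a Hermitian block matrix on `m ⊕ n` with `P` invertible and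
`P ≥ 0`, and suppose the NEGATIVE Schur complement `Q := −(C − B P⁻¹ Bᴴ)` is coercive in a weighted norm,
`ĝ Σ_s |y_s|²/ω_s ≤ Re⟨y, Q y⟩`.  For the saddle functional `S(x) = 2Re⟨x,v⟩ − Re⟨x,Nx⟩` and ANY `x`, with the
saddle residual `e := Nx − v` and its Schur-reduced shell part `ẽ := e_S − B P⁻¹ e_D`,

  `Re⟨v, N⁻¹ v⟩ ≥ S(x) − (1/ĝ) Σ_s ω_s |ẽ_s|²`        (`saddle_lower_bound`).

Proof: `Re⟨v,N⁻¹v⟩ = S(x) + Re⟨h,Nh⟩` with `h = x − N⁻¹v`, `Nh = e`; completing the square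
(`Fibre3.schur_complete`) `Re⟨h,Nh⟩ = Re⟨w,Pw⟩ − Re⟨h_S, Q h_S⟩ ≥ −Re⟨h_S,Qh_S⟩`, the block equations give
`Q h_S = −ẽ`, and the weighted coercivity gives `Re⟨h_S, Q h_S⟩ ≤ (1/ĝ)Σ ω_s|ẽ_s|²` (`weighted_penalty`).
In the application (`…Fibre3MasterInequality`): `N = 𝒩(T)` (Krein matrix), `x = −(Krein charge)`, `e = (G_T R′)|_{D⊕S}`,
`ẽ = (G^D_T R′)|_S`, `ω_s = ΔW_s`, `ĝ = ĝ₀` of LEMMA L2/κ₀.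
Prover seat `hubbard-h0-rotor-p1` g22; helper for stmt-HubbardSuperconductivity-19089 (`--supports`).
-/

set_option linter.dupNamespace false
set_option autoImplicit false

noncomputable section

open scoped BigOperators
open Complex Matrix

namespace Summit.HubbardSuperconductivity.HubbardSuperconductivity.Theorems.AnisotropyChord.Transfer.Saddle

variable {m n : Type} [Fintype m] [Fintype n] [DecidableEq m] [DecidableEq n]

/-! ## Small Hermitian-form facts -/

omit [DecidableEq n] in
/-- `Re Σ_s conj(y_s) r_s ≤ Σ_s ‖y_s‖‖r_s‖`. [folklore] -/
theorem re_dotProduct_le_sum_norm (y r : n → ℂ) : (star y ⬝ᵥ r).re ≤ ∑ s, ‖y s‖ * ‖r s‖ := by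
  simp only [dotProduct, Pi.star_apply, Complex.re_sum]
  apply Finset.sum_le_sum
  intro s _
  refine le_trans (Complex.re_le_norm _) ?_
  rw [norm_mul, Complex.star_def, Complex.norm_conj]

omit [DecidableEq n] in
/-- **weighted penalty bound:** if `Q y = r` and `ĝ Σ_s ‖y_s‖²/ω_s ≤ Re⟨y, Q y⟩` (`ĝ, ω_s > 0`), then
`Re⟨y, Q y⟩ ≤ (Σ_s ω_s ‖r_s‖²)/ĝ`.  (Cauchy–Schwarz in the pair of dual weighted norms.) [folklore] -/
theorem weighted_penalty (Q : Matrix n n ℂ) (y r : n → ℂ) (hy : Q *ᵥ y = r) (ω : n → ℝ) (hω : ∀ s, 0 < ω s)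
    (g : ℝ) (hg : 0 < g) (hcoer : g * ∑ s, ‖y s‖ ^ 2 / ω s ≤ (star y ⬝ᵥ Q *ᵥ y).re) :
    (star y ⬝ᵥ Q *ᵥ y).re ≤ (∑ s, ω s * ‖r s‖ ^ 2) / g := by
  set q : ℝ := (star y ⬝ᵥ Q *ᵥ y).re with hq
  have hqr : q = (star y ⬝ᵥ r).re := by rw [hq, hy]
  -- pointwise AM–GM with weights
  have hpt : ∀ s, ‖y s‖ * ‖r s‖ ≤ (g * (‖y s‖ ^ 2 / ω s) + ω s * ‖r s‖ ^ 2 / g) / 2 := by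
    intro s
    have hω' := hω s
    have key : 2 * (‖y s‖ * ‖r s‖) * (g * ω s) ≤ g ^ 2 * ‖y s‖ ^ 2 + (ω s) ^ 2 * ‖r s‖ ^ 2 := by
      nlinarith [sq_nonneg (g * ‖y s‖ - ω s * ‖r s‖)]
    have e : (g * (‖y s‖ ^ 2 / ω s) + ω s * ‖r s‖ ^ 2 / g) / 2
        = (g ^ 2 * ‖y s‖ ^ 2 + (ω s) ^ 2 * ‖r s‖ ^ 2) / (2 * (g * ω s)) := by
      field_simp
    rw [e, le_div_iff₀ (by positivity)]
    linarith
  have h1 : q ≤ ∑ s, ‖y s‖ * ‖r s‖ := by rw [hqr]; exact re_dotProduct_le_sum_norm y r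
  have h2 : ∑ s, ‖y s‖ * ‖r s‖ ≤ (g * ∑ s, ‖y s‖ ^ 2 / ω s + (∑ s, ω s * ‖r s‖ ^ 2) / g) / 2 := by
    refine le_trans (Finset.sum_le_sum fun s _ => hpt s) ?_
    rw [← Finset.sum_div, Finset.sum_add_distrib, Finset.mul_sum, Finset.sum_div]
  -- q ≤ (q + B/g)/2
  have h3 : q ≤ (q + (∑ s, ω s * ‖r s‖ ^ 2) / g) / 2 := by linarith
  linarith

omit [Fintype n] [DecidableEq n] in
/-- `B P⁻¹ (P a + b) = B a + B P⁻¹ b` for invertible `P`. [folklore] -/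
theorem mul_inv_cancel_vec (P : Matrix m m ℂ) (B : Matrix n m ℂ) (hdetP : IsUnit P.det) (a b : m → ℂ) :
    B *ᵥ (P⁻¹ *ᵥ (P *ᵥ a + b)) = B *ᵥ a + B *ᵥ (P⁻¹ *ᵥ b) := by
  rw [Matrix.mulVec_add, Matrix.mulVec_mulVec, Matrix.nonsing_inv_mul _ hdetP, Matrix.one_mulVec,
    Matrix.mulVec_add]

/-! ## The saddle-point lower bound -/

/-- **SADDLE-POINT LOWER BOUND** (abstract (KT-EXACT), memo 20 §282(a)): for the Hermitian block matrix
`N = [[P,Bᴴ],[B,C]]` with `P ≥ 0` invertible, `N` invertible, and `Q = −(C − BP⁻¹Bᴴ)` coercive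
(`ĝ Σ_s |y_s|²/ω_s ≤ Re⟨y,Qy⟩`), every `x` with saddle residual `e = Nx − v` and reduced residual
`ẽ_s = e_s − (B P⁻¹ e_D)_s` satisfies `2Re⟨x,v⟩ − Re⟨x,Nx⟩ − (Σ_s ω_s|ẽ_s|²)/ĝ ≤ Re⟨v, N⁻¹ v⟩`. [folklore] -/
theorem saddle_lower_bound
    (P : Matrix m m ℂ) (BH : Matrix m n ℂ) (B : Matrix n m ℂ) (C : Matrix n n ℂ)
    (hP : Pᴴ = P) (hB : BHᴴ = B)
    (hNH : (Matrix.fromBlocks P BH B C)ᴴ = Matrix.fromBlocks P BH B C)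
    (hdetP : IsUnit P.det) (hdetN : IsUnit (Matrix.fromBlocks P BH B C).det)
    (hPnn : ∀ w : m → ℂ, 0 ≤ (star w ⬝ᵥ P *ᵥ w).re)
    (ω : n → ℝ) (hω : ∀ s, 0 < ω s) (g : ℝ) (hg : 0 < g)
    (hcoer : ∀ y : n → ℂ, g * ∑ s, ‖y s‖ ^ 2 / ω s ≤ (star y ⬝ᵥ (-(C - B * P⁻¹ * BH)) *ᵥ y).re)
    (v x e : m ⊕ n → ℂ) (he : (Matrix.fromBlocks P BH B C) *ᵥ x - v = e)
    (et : n → ℂ) (het : ∀ s, et s = e (Sum.inr s) - (B *ᵥ (P⁻¹ *ᵥ fun d => e (Sum.inl d))) s) :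
    2 * (star x ⬝ᵥ v).re - (star x ⬝ᵥ (Matrix.fromBlocks P BH B C) *ᵥ x).re - (∑ s, ω s * ‖et s‖ ^ 2) / g
      ≤ (star v ⬝ᵥ (Matrix.fromBlocks P BH B C)⁻¹ *ᵥ v).re := by
  set N := Matrix.fromBlocks P BH B C with hN
  have hNherm : N.IsHermitian := hNH
  -- the saddle point
  set x₀ : m ⊕ n → ℂ := N⁻¹ *ᵥ v with hx₀
  have hNx₀ : N *ᵥ x₀ = v := by
    rw [hx₀, Matrix.mulVec_mulVec, Matrix.mul_nonsing_inv _ hdetN, Matrix.one_mulVec]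
  set h : m ⊕ n → ℂ := x - x₀ with hh
  have hx : x = x₀ + h := by rw [hh]; abel
  have hNh : N *ᵥ h = e := by rw [hh, Matrix.mulVec_sub, hNx₀]; exact he
  -- S(x) = Re⟨x₀, v⟩ − Re⟨h, N h⟩
  have hsym : (star x₀ ⬝ᵥ N *ᵥ h).re = (star h ⬝ᵥ v).re := by
    rw [JF1.re_dot_mulVec_symm N hNherm x₀ h]
    show (star h ⬝ᵥ N *ᵥ x₀).re = _
    rw [hNx₀]
  have key1 : 2 * (star x ⬝ᵥ v).re - (star x ⬝ᵥ N *ᵥ x).re = (star x₀ ⬝ᵥ v).re - (star h ⬝ᵥ N *ᵥ h).re := by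
    have e1 : star x ⬝ᵥ v = star x₀ ⬝ᵥ v + star h ⬝ᵥ v := by rw [hx, star_add, add_dotProduct]
    have e2 : star x ⬝ᵥ N *ᵥ x = star x₀ ⬝ᵥ v + star x₀ ⬝ᵥ N *ᵥ h + star h ⬝ᵥ v + star h ⬝ᵥ N *ᵥ h := by
      rw [hx, star_add, Matrix.mulVec_add, hNx₀, add_dotProduct, dotProduct_add, dotProduct_add]; ring
    rw [e1, e2]
    simp only [Complex.add_re]
    rw [hsym]; ring
  -- Φ side
  have key2 : (star v ⬝ᵥ N⁻¹ *ᵥ v).re = (star x₀ ⬝ᵥ v).re := by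
    rw [← hx₀, Matrix.star_dotProduct v x₀, Complex.star_def, Complex.conj_re]
  -- block decomposition of h
  set hD : m → ℂ := fun d => h (Sum.inl d) with hhD
  set hS : n → ℂ := fun s => h (Sum.inr s) with hhS
  have hdec : h = Sum.elim hD hS := by
    funext i; cases i <;> rfl
  have hsq := Fibre3.schur_complete P BH B C hP hB hdetP hD hS
  rw [← hdec] at hsq
  -- block equations: e_D = P hD + BH hS, e_S = B hD + C hS
  have hblk : e = Sum.elim (P *ᵥ hD + BH *ᵥ hS) (B *ᵥ hD + C *ᵥ hS) := by
    rw [← hNh, hdec, hN, Matrix.fromBlocks_mulVec]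
    simp only [Sum.elim_comp_inl, Sum.elim_comp_inr]
  have heD : (fun d => e (Sum.inl d)) = P *ᵥ hD + BH *ᵥ hS := by
    funext d; rw [hblk]; rfl
  have heS : ∀ s, e (Sum.inr s) = (B *ᵥ hD + C *ᵥ hS) s := by
    intro s; rw [hblk]; rfl
  -- ẽ = (C − B P⁻¹ BH) hS, i.e. Q hS = −ẽ
  have hQ : (-(C - B * P⁻¹ * BH)) *ᵥ hS = -et := by
    funext s
    rw [Matrix.neg_mulVec, Pi.neg_apply, Pi.neg_apply, het s, heD, heS s, mul_inv_cancel_vec P B hdetP]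
    rw [Matrix.sub_mulVec, Matrix.mulVec_mulVec, Matrix.mulVec_mulVec]
    simp only [Pi.add_apply, Pi.sub_apply]
    ring
  -- penalty
  have hpen := weighted_penalty (-(C - B * P⁻¹ * BH)) hS (-et) hQ ω hω g hg (hcoer hS)
  have hnorm : ∑ s, ω s * ‖(-et) s‖ ^ 2 = ∑ s, ω s * ‖et s‖ ^ 2 := by
    refine Finset.sum_congr rfl fun s _ => ?_; rw [Pi.neg_apply, norm_neg]
  rw [hnorm] at hpen
  -- Re⟨h, N h⟩ = Re⟨w, P w⟩ + Re⟨hS, (C − BP⁻¹BH) hS⟩ ≥ −Re⟨hS, Q hS⟩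
  have hform : (star h ⬝ᵥ N *ᵥ h).re
      = (star (hD + P⁻¹ *ᵥ (BH *ᵥ hS)) ⬝ᵥ P *ᵥ (hD + P⁻¹ *ᵥ (BH *ᵥ hS))).re
        - (star hS ⬝ᵥ (-(C - B * P⁻¹ * BH)) *ᵥ hS).re := by
    rw [← hN] at hsq
    rw [hsq, Complex.add_re, Matrix.neg_mulVec, dotProduct_neg, Complex.neg_re]
    ring
  have hw := hPnn (hD + P⁻¹ *ᵥ (BH *ᵥ hS))
  rw [key1, key2]
  linarith [hform, hw, hpen]

end Summit.HubbardSuperconductivity.HubbardSuperconductivity.Theorems.AnisotropyChord.Transfer.Saddle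

end
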